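import Mathlib
import HarnessLib
import Summits.NavierStokesRegularity.NavierStokesRegularity.Theorems.PoloidalWindowDoorLrcModEntireRidgeQuasiconvex
import Summits.NavierStokesRegularity.NavierStokesRegularity.Theorems.PoloidalWindowDoorLrcModEntireTubeChart
import Summits.NavierStokesRegularity.NavierStokesRegularity.Theorems.PoloidalWindowDoorLrcModEntireRidgeBranchCurvature

/-!
# Item `LrcModEntire` (stmt-NavierStokesRegularity-20428) — (Q3∞) toolkit: (Q1) RIDGE QUASICONVEXITY WITHOUT AN INJECTIVE CHART, and the tube map of a complete branch is OPEN

ns-k2-port-2 g5 (helper prover under the LEAD of item 20428, ns-poloidal-K2-p3 g14; `--supports stmt-NavierStokesRegularity-20428 --as helper`).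
Memo `Cruxes/LrcModEntire/T2B-g14.md` §13b (Q3∞) needs ONE tube radius `r` along a whole unbounded hot branch; the normal map `(a,n) ↦ γ a + n ν a` of a complete branch need
not be injective on `ℝ × (−r,r)` (the branch may come back near itself), so the LEAD's (Q1) `…RidgeQuasiconvex.exists_end_ge_of_peakless` (chart = `OpenPartialHomeomorph`)
is re-proved here from what its proof actually uses — continuity of the planar tube map on the closed rectangle and OPENNESS of the images of the open sub-rectangles:

* `exists_end_ge_of_peakless_of_isOpen`, `crossSectionMax_quasiconvexOn_of_isOpen` — (Q1) with `Φ : ℝ × ℝ → ℝ × ℝ` continuous on `[a₁,a₂] × [−r,r]` and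
  `Φ '' (Ioo b₁ b₂ ×ˢ Ioo (−r) r)` open for all `a₁ ≤ b₁`, `b₂ ≤ a₂` (proof = the LEAD's, verbatim otherwise);
* `isOpen_image_of_hasStrictFDerivAt_equiv` — a map with invertible strict derivative at every point of an open set `S` sends open subsets of `S` to open sets
  (`HasStrictFDerivAt.map_nhds_eq_of_equiv`);
* `det_tube_eq`, `isOpen_image_planarTube` — for a `C²` branch `γ ⊂ P₀ ⊂ ℝ³` of Euclidean unit speed with `‖γ″‖ ≤ B`, the PLANAR tube map
  `Φ (a,n) = ((γ a)₀ − n (γ′ a)₁, (γ a)₁ + n (γ′ a)₀)` has `det DΦ(a,n) = 1 − n·c(a)` (`c` = signed curvature, `|c| ≤ B`), so for `r·B < 1` it is a local diffeomorphism on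
  `ℝ × (−r, r)` and maps open subsets of that strip to open sets — the `hopen` input of the first bullet, uniformly along the branch.

WHAT THIS IS NOT: not a claim about Navier–Stokes regularity — a chart-free form of a rung of the «ridge quasiconvexity» lever on hypothetical profiles (bears_on LADDER-NS N0, item 20428 /
crux 19708; 20428/19708/27893 OPEN).  No summit statement is proved here.
-/

noncomputable section

-- the summit and its single sub-problem share the name (CONVENTIONS §1), as in every Theorems file
set_option linter.dupNamespace false

namespace Summit.NavierStokesRegularity.NavierStokesRegularity.Theorems.PoloidalWindowDoorLrcModEntireRidgeQuasiconvexOpen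

open Set Filter Topology Metric Function
open Summit.NavierStokesRegularity.NavierStokesRegularity.Theorems.PoloidalWindowDoorLrcModEntirePeaklessPlanarMaxPrinciple
open Summit.NavierStokesRegularity.NavierStokesRegularity.Theorems.PoloidalWindowDoorLrcModEntireRidgeQuasiconvex
open Summit.NavierStokesRegularity.NavierStokesRegularity.Theorems.PoloidalWindowDoorLrcModEntireTubeChart
open Summit.NavierStokesRegularity.NavierStokesRegularity.Theorems.PoloidalWindowDoorLrcModEntireRidgeBranchCurvature

variable {v : ℝ → EuclideanSpace ℝ (Fin 3) → EuclideanSpace ℝ (Fin 3)}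

/-! ### (Q1) without injectivity of the chart -/

/-- **(Q1) RIDGE QUASICONVEXITY, open-map form: the maximum over a sub-tube sits on an END cross-section.**  As `…RidgeQuasiconvex.exists_end_ge_of_peakless`, with the
`OpenPartialHomeomorph` replaced by a planar tube map `Φ` that is continuous on the closed rectangle and maps the open sub-rectangles to open sets. -/
theorem exists_end_ge_of_peakless_of_isOpen
    (hpk : ∀ (s z₀ σ M : ℝ) (K O : Set (EuclideanSpace ℝ (Fin 3))), s < 0 →
      ((σ = 1 ∨ σ = -1) ∧ IsCompact K ∧ K.Nonempty ∧ (∀ y ∈ K, y 2 = z₀ ∧ σ * v s y 2 = M) ∧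
        IsOpen O ∧ K ⊆ O ∧ (∀ y ∈ O, y 2 = z₀ → σ * v s y 2 ≤ M) ∧
        (∀ y ∈ O, y 2 = z₀ → σ * v s y 2 = M → y ∈ K)) → False)
    {s : ℝ} (hs : s < 0) {z₀ σ : ℝ} (hσ : σ = 1 ∨ σ = -1) (hvc : Continuous fun y => v s y 2)
    {P : ℝ × ℝ → EuclideanSpace ℝ (Fin 3)} (hP : ∀ q, P q = WithLp.toLp 2 ![q.1, q.2, z₀])
    {Φ : ℝ × ℝ → ℝ × ℝ} {a₁ a₂ r : ℝ} (hr : 0 ≤ r) (hΦc : ContinuousOn Φ (Icc a₁ a₂ ×ˢ Icc (-r) r))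
    (hopen : ∀ b₁ b₂, a₁ ≤ b₁ → b₂ ≤ a₂ → IsOpen (Φ '' (Ioo b₁ b₂ ×ˢ Ioo (-r) r)))
    {m : ℝ} (hlat : ∀ a ∈ Icc a₁ a₂, ∀ n : ℝ, (n = r ∨ n = -r) → σ * v s (P (Φ (a, n))) 2 < m)
    (hmid : ∀ a ∈ Icc a₁ a₂, m ≤ σ * v s (P (Φ (a, 0))) 2)
    {b₁ c b₂ : ℝ} (hb₁ : a₁ ≤ b₁) (hc₁ : b₁ ≤ c) (hc₂ : c ≤ b₂) (hb₂ : b₂ ≤ a₂) {n : ℝ} (hn : n ∈ Icc (-r) r) :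
    ∃ a : ℝ, (a = b₁ ∨ a = b₂) ∧ ∃ n' ∈ Icc (-r) r,
      σ * v s (P (Φ (c, n))) 2 ≤ σ * v s (P (Φ (a, n'))) 2 := by
  obtain ⟨hP0, hP1, hP2, hPc⟩ := planePoint_facts hP
  set f : EuclideanSpace ℝ (Fin 3) → ℝ := fun y => σ * v s y 2 with hf
  set Q : Set (ℝ × ℝ) := Icc b₁ b₂ ×ˢ Icc (-r) r with hQ
  set Qo : Set (ℝ × ℝ) := Ioo b₁ b₂ ×ˢ Ioo (-r) r with hQo
  have hQsub : Q ⊆ Icc a₁ a₂ ×ˢ Icc (-r) r := prod_mono (Icc_subset_Icc hb₁ hb₂) Subset.rfl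
  have hQc : IsCompact Q := isCompact_Icc.prod isCompact_Icc
  set D : Set (EuclideanSpace ℝ (Fin 3)) := P '' (Φ '' Q) with hD
  have hDc : IsCompact D := (hQc.image_of_continuousOn (hΦc.mono hQsub)).image hPc
  have hcQ : (c, n) ∈ Q := ⟨⟨hc₁, hc₂⟩, hn⟩
  have hDne : D.Nonempty := ⟨P (Φ (c, n)), Φ (c, n), ⟨(c, n), hcQ, rfl⟩, rfl⟩
  have hDz : ∀ y ∈ D, y 2 = z₀ := by
    rintro y ⟨q, -, rfl⟩; exact hP2 q
  set U : Set (EuclideanSpace ℝ (Fin 3)) := {y | ((y 0, y 1) : ℝ × ℝ) ∈ Φ '' Qo} with hU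
  have hQoQ : Qo ⊆ Q := prod_mono Ioo_subset_Icc_self Ioo_subset_Icc_self
  have hUo : IsOpen U := by
    have h2 : Continuous fun y : EuclideanSpace ℝ (Fin 3) => ((y 0, y 1) : ℝ × ℝ) :=
      ((EuclideanSpace.proj (𝕜 := ℝ) (0 : Fin 3)).continuous).prodMk ((EuclideanSpace.proj (𝕜 := ℝ) (1 : Fin 3)).continuous)
    exact (hopen b₁ b₂ hb₁ hb₂).preimage h2
  have hUD : ∀ y ∈ U, y 2 = z₀ → y ∈ D := by
    intro y hy hyz
    obtain ⟨q, hq, hqe⟩ := hy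
    refine ⟨Φ q, ⟨q, hQoQ hq, rfl⟩, ?_⟩
    rw [hP]
    ext i
    fin_cases i
    · simpa using congrArg Prod.fst hqe
    · simpa using congrArg Prod.snd hqe
    · simpa using hyz.symm
  -- (Q0)
  obtain ⟨y, ⟨hyD, hyU⟩, hmax⟩ :=
    exists_isMaxOn_diff_of_peakless hpk hs hσ hDc hDne hDz (hvc.continuousOn) hUo hUD
  obtain ⟨q', ⟨q, hq, rfl⟩, rfl⟩ := hyD
  have hqo : q ∉ Qo := fun hq' => hyU ⟨q, hq', by simp [hP0, hP1]⟩
  obtain ⟨⟨hq1l, hq1r⟩, ⟨hq2l, hq2r⟩⟩ := hq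
  have hqa : q.1 ∈ Icc a₁ a₂ := ⟨hb₁.trans hq1l, hq1r.trans hb₂⟩
  have hge : m ≤ f (P (Φ q)) := by
    have h0Q : (q.1, (0 : ℝ)) ∈ Q := ⟨⟨hq1l, hq1r⟩, ⟨by linarith, hr⟩⟩
    exact (hmid q.1 hqa).trans (hmax _ ⟨Φ (q.1, 0), ⟨(q.1, 0), h0Q, rfl⟩, rfl⟩)
  have hnotlat : ¬ (q.2 = r ∨ q.2 = -r) := fun hl => by
    have := hlat q.1 hqa q.2 hl
    rw [show (q.1, q.2) = q from rfl] at this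
    exact absurd hge (not_le.2 this)
  have hends : q.1 = b₁ ∨ q.1 = b₂ := by
    by_contra hcon
    push Not at hcon
    have h1 : q.1 ∈ Ioo b₁ b₂ := ⟨lt_of_le_of_ne hq1l (Ne.symm hcon.1), lt_of_le_of_ne hq1r hcon.2⟩
    have h2 : q.2 ∈ Ioo (-r) r := by
      push Not at hnotlat
      exact ⟨lt_of_le_of_ne hq2l (Ne.symm hnotlat.2), lt_of_le_of_ne hq2r hnotlat.1⟩
    exact hqo ⟨h1, h2⟩
  refine ⟨q.1, hends, q.2, ⟨hq2l, hq2r⟩, ?_⟩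
  have := hmax (P (Φ (c, n))) ⟨Φ (c, n), ⟨(c, n), hcQ, rfl⟩, rfl⟩
  simpa [hf] using this

/-- **(Q1), open-map form, in Mathlib's language: the cross-section maximum is quasiconvex along the tube.** -/
theorem crossSectionMax_quasiconvexOn_of_isOpen
    (hpk : ∀ (s z₀ σ M : ℝ) (K O : Set (EuclideanSpace ℝ (Fin 3))), s < 0 →
      ((σ = 1 ∨ σ = -1) ∧ IsCompact K ∧ K.Nonempty ∧ (∀ y ∈ K, y 2 = z₀ ∧ σ * v s y 2 = M) ∧
        IsOpen O ∧ K ⊆ O ∧ (∀ y ∈ O, y 2 = z₀ → σ * v s y 2 ≤ M) ∧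
        (∀ y ∈ O, y 2 = z₀ → σ * v s y 2 = M → y ∈ K)) → False)
    {s : ℝ} (hs : s < 0) {z₀ σ : ℝ} (hσ : σ = 1 ∨ σ = -1) (hvc : Continuous fun y => v s y 2)
    {P : ℝ × ℝ → EuclideanSpace ℝ (Fin 3)} (hP : ∀ q, P q = WithLp.toLp 2 ![q.1, q.2, z₀])
    {Φ : ℝ × ℝ → ℝ × ℝ} {a₁ a₂ r : ℝ} (hr : 0 ≤ r) (hΦc : ContinuousOn Φ (Icc a₁ a₂ ×ˢ Icc (-r) r))
    (hopen : ∀ b₁ b₂, a₁ ≤ b₁ → b₂ ≤ a₂ → IsOpen (Φ '' (Ioo b₁ b₂ ×ˢ Ioo (-r) r)))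
    {m : ℝ} (hlat : ∀ a ∈ Icc a₁ a₂, ∀ n : ℝ, (n = r ∨ n = -r) → σ * v s (P (Φ (a, n))) 2 < m)
    (hmid : ∀ a ∈ Icc a₁ a₂, m ≤ σ * v s (P (Φ (a, 0))) 2) :
    QuasiconvexOn ℝ (Icc a₁ a₂) fun a => sSup ((fun n : ℝ => σ * v s (P (Φ (a, n))) 2) '' Icc (-r) r) := by
  obtain ⟨-, -, -, hPc⟩ := planePoint_facts hP
  set F : ℝ → ℝ → ℝ := fun a n => σ * v s (P (Φ (a, n))) 2 with hF
  have hsec : ∀ a ∈ Icc a₁ a₂, IsCompact (F a '' Icc (-r) r) ∧ (F a '' Icc (-r) r).Nonempty := by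
    intro a ha
    refine ⟨isCompact_Icc.image_of_continuousOn ?_, ⟨F a 0, 0, ⟨by linarith, hr⟩, rfl⟩⟩
    have hline : ContinuousOn (fun n : ℝ => Φ (a, n)) (Icc (-r) r) :=
      hΦc.comp (Continuous.continuousOn (by fun_prop)) fun n hn => ⟨ha, hn⟩
    exact (continuousOn_const.mul ((hvc.comp hPc).comp_continuousOn hline))
  have hle : ∀ a ∈ Icc a₁ a₂, ∀ n ∈ Icc (-r) r, F a n ≤ sSup (F a '' Icc (-r) r) := fun a ha n hn =>
    le_csSup (hsec a ha).1.bddAbove ⟨n, hn, rfl⟩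
  have hmem : ∀ a ∈ Icc a₁ a₂, sSup (F a '' Icc (-r) r) ∈ F a '' Icc (-r) r := fun a ha =>
    (hsec a ha).1.sSup_mem (hsec a ha).2
  rw [quasiconvexOn_iff_le_max]
  refine ⟨convex_Icc a₁ a₂, fun x hx y hy a b ha hb hab => ?_⟩
  have hc : a • x + b • y ∈ Icc a₁ a₂ := (convex_Icc a₁ a₂) hx hy ha hb hab
  obtain ⟨n₀, hn₀, hn₀eq⟩ := hmem _ hc
  rw [← hn₀eq]
  rcases le_total x y with hxy | hxy
  · have e1 : a • x + b • y = x + b * (y - x) := by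
      rw [smul_eq_mul, smul_eq_mul, show a = 1 - b by linarith]; ring
    have e2 : a • x + b • y = y - a * (y - x) := by
      rw [smul_eq_mul, smul_eq_mul, show b = 1 - a by linarith]; ring
    have hcx : x ≤ a • x + b • y := by rw [e1]; nlinarith [mul_nonneg hb (sub_nonneg.2 hxy)]
    have hcy : a • x + b • y ≤ y := by rw [e2]; nlinarith [mul_nonneg ha (sub_nonneg.2 hxy)]
    obtain ⟨a', ha', n', hn', hle'⟩ := exists_end_ge_of_peakless_of_isOpen hpk hs hσ hvc hP hr hΦc hopen hlat hmid hx.1 hcx hcy hy.2 hn₀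
    rcases ha' with rfl | rfl
    · exact (hle'.trans (hle _ hx n' hn')).trans (le_max_left _ _)
    · exact (hle'.trans (hle _ hy n' hn')).trans (le_max_right _ _)
  · have e1 : a • x + b • y = y + a * (x - y) := by
      rw [smul_eq_mul, smul_eq_mul, show b = 1 - a by linarith]; ring
    have e2 : a • x + b • y = x - b * (x - y) := by
      rw [smul_eq_mul, smul_eq_mul, show a = 1 - b by linarith]; ring
    have hcy : y ≤ a • x + b • y := by rw [e1]; nlinarith [mul_nonneg ha (sub_nonneg.2 hxy)]
    have hcx : a • x + b • y ≤ x := by rw [e2]; nlinarith [mul_nonneg hb (sub_nonneg.2 hxy)]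
    obtain ⟨a', ha', n', hn', hle'⟩ := exists_end_ge_of_peakless_of_isOpen hpk hs hσ hvc hP hr hΦc hopen hlat hmid hy.1 hcy hcx hx.2 hn₀
    rcases ha' with rfl | rfl
    · exact (hle'.trans (hle _ hy n' hn')).trans (le_max_right _ _)
    · exact (hle'.trans (hle _ hx n' hn')).trans (le_max_left _ _)

/-! ### Open images from an invertible strict derivative -/

/-- A map with an invertible strict derivative at every point of an open set `S` maps open subsets of `S` to open sets. [folklore] -/
theorem isOpen_image_of_hasStrictFDerivAt_equiv {E F : Type*} [NormedAddCommGroup E] [NormedSpace ℝ E] [CompleteSpace E] [NormedAddCommGroup F] [NormedSpace ℝ F]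
    {g : E → F} {S : Set E} (hg : ∀ x ∈ S, ∃ L : E ≃L[ℝ] F, HasStrictFDerivAt g (L : E →L[ℝ] F) x)
    {W : Set E} (hW : IsOpen W) (hWS : W ⊆ S) : IsOpen (g '' W) := by
  rw [isOpen_iff_mem_nhds]
  rintro _ ⟨x, hx, rfl⟩
  obtain ⟨L, hL⟩ := hg x (hWS hx)
  rw [← hL.map_nhds_eq_of_equiv]
  exact Filter.image_mem_map (hW.mem_nhds hx)

/-! ### The planar tube map of a complete branch is open -/

variable {γ : ℝ → EuclideanSpace ℝ (Fin 3)}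

/-- **Derivative and determinant of the planar tube map** of a `C²` branch `γ ⊂ P₀` of Euclidean unit speed: `Φ (a,n) = ((γ a)₀ − n(γ′ a)₁, (γ a)₁ + n(γ′ a)₀)` has at `(a,n)`
the derivative `(h,k) ↦ h•(γ₂′ a + n•ν₂′ a) + k•ν₂ a` with `γ₂′ = ((γ′)₀,(γ′)₁)`, `ν₂ = (−(γ′)₁,(γ′)₀)`, `ν₂′ = (−(γ″)₁,(γ″)₀)`, and its determinant is `1 − n·c(a)` with
`c(a) = (γ′ a)₀(γ″ a)₁ − (γ′ a)₁(γ″ a)₀` the signed curvature. [folklore] -/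
theorem hasFDerivAt_planarTube (hγ2 : ContDiff ℝ 2 γ) {Φ : ℝ × ℝ → ℝ × ℝ}
    (hΦ : ∀ p : ℝ × ℝ, Φ p = ((γ p.1 0 + p.2 * (-(deriv γ p.1 1)), γ p.1 1 + p.2 * deriv γ p.1 0) : ℝ × ℝ)) (a n : ℝ) :
    HasFDerivAt Φ
      ((ContinuousLinearMap.fst ℝ ℝ ℝ).smulRight
          (((deriv γ a 0, deriv γ a 1) : ℝ × ℝ) + n • ((-(deriv (deriv γ) a 1), deriv (deriv γ) a 0) : ℝ × ℝ)) +
        (ContinuousLinearMap.snd ℝ ℝ ℝ).smulRight ((-(deriv γ a 1), deriv γ a 0) : ℝ × ℝ)) (a, n) := by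
  have hγd : Differentiable ℝ γ := hγ2.differentiable (by norm_num)
  have hγ'd : Differentiable ℝ (deriv γ) := hγ2.differentiable_deriv_two
  -- the planar curve and normal field
  set γ₂ : ℝ → ℝ × ℝ := fun a => ((γ a 0, γ a 1) : ℝ × ℝ) with hγ₂
  set ν₂ : ℝ → ℝ × ℝ := fun a => ((-(deriv γ a 1), deriv γ a 0) : ℝ × ℝ) with hν₂
  have hγ₂d : HasDerivAt γ₂ ((deriv γ a 0, deriv γ a 1) : ℝ × ℝ) a :=
    (hasDerivAt_apply_coord hγd 0 a).prodMk (hasDerivAt_apply_coord hγd 1 a)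
  have hν₂d : HasDerivAt ν₂ ((-(deriv (deriv γ) a 1), deriv (deriv γ) a 0) : ℝ × ℝ) a :=
    (hasDerivAt_apply_coord hγ'd 1 a).neg.prodMk (hasDerivAt_apply_coord hγ'd 0 a)
  have h := hasFDerivAt_tube hγ₂d hν₂d n
  have hΦeq : Φ = fun p : ℝ × ℝ => γ₂ p.1 + p.2 • ν₂ p.1 := by
    funext p; rw [hΦ p]; ext <;> simp [hγ₂, hν₂]
  rw [hΦeq]
  exact h

/-- **The planar tube map of a complete branch with curvature `≤ B` is OPEN on the strip `ℝ × (−r, r)`, `r·B < 1`.**  (Euclidean unit speed `⇒ γ″ = c•ν` with `|c| = ‖γ″‖ ≤ B`,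
`det DΦ = 1 − n·c ≥ 1 − rB > 0`; inverse function theorem at every point.) [folklore] -/
theorem isOpen_image_planarTube (hγ2 : ContDiff ℝ 2 γ) (hplane : ∀ s, γ s 2 = 0) (hunit : ∀ s, ‖deriv γ s‖ = 1) {B r : ℝ}
    (hB : ∀ s, ‖deriv (deriv γ) s‖ ≤ B) (hrB : r * B < 1) {Φ : ℝ × ℝ → ℝ × ℝ}
    (hΦ : ∀ p : ℝ × ℝ, Φ p = ((γ p.1 0 + p.2 * (-(deriv γ p.1 1)), γ p.1 1 + p.2 * deriv γ p.1 0) : ℝ × ℝ))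
    {W : Set (ℝ × ℝ)} (hW : IsOpen W) (hWS : W ⊆ (univ : Set ℝ) ×ˢ Ioo (-r) r) : IsOpen (Φ '' W) := by
  have hγd : Differentiable ℝ γ := hγ2.differentiable (by norm_num)
  have hγ'd : Differentiable ℝ (deriv γ) := hγ2.differentiable_deriv_two
  refine isOpen_image_of_hasStrictFDerivAt_equiv (S := (univ : Set ℝ) ×ˢ Ioo (-r) r) (fun p hp => ?_) hW hWS
  obtain ⟨a, n⟩ := p
  have hn : n ∈ Ioo (-r) r := hp.2
  -- the signed curvature and the determinant
  set c : ℝ := deriv γ a 0 * deriv (deriv γ) a 1 - deriv γ a 1 * deriv (deriv γ) a 0 with hc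
  have hacc : deriv (deriv γ) a = c • WithLp.toLp 2 ![-(deriv γ a 1), deriv γ a 0, 0] := by
    rw [hc]; exact deriv_deriv_eq_smul_planeNormal hγ2 hplane hunit a
  have hnorm1 : ‖(WithLp.toLp 2 ![-(deriv γ a 1), deriv γ a 0, 0] : EuclideanSpace ℝ (Fin 3))‖ = 1 :=
    norm_planeNormal_eq_one hγd hplane hunit (ν₃ := fun a => WithLp.toLp 2 ![-(deriv γ a 1), deriv γ a 0, 0]) (fun _ => rfl) a
  have hcB : |c| ≤ B := by
    have h := hB a
    rw [hacc, norm_smul, hnorm1, mul_one, Real.norm_eq_abs] at h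
    exact h
  have hsq := sq_add_sq_eq_one_of_unit hγd hplane hunit a
  have hdet : ((deriv γ a 0, deriv γ a 1) + n • ((-(deriv (deriv γ) a 1), deriv (deriv γ) a 0) : ℝ × ℝ) : ℝ × ℝ).1 * (deriv γ a 0) -
      ((deriv γ a 0, deriv γ a 1) + n • ((-(deriv (deriv γ) a 1), deriv (deriv γ) a 0) : ℝ × ℝ) : ℝ × ℝ).2 * (-(deriv γ a 1)) ≠ 0 := by
    have e : ((deriv γ a 0, deriv γ a 1) + n • ((-(deriv (deriv γ) a 1), deriv (deriv γ) a 0) : ℝ × ℝ) : ℝ × ℝ).1 * (deriv γ a 0) -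
        ((deriv γ a 0, deriv γ a 1) + n • ((-(deriv (deriv γ) a 1), deriv (deriv γ) a 0) : ℝ × ℝ) : ℝ × ℝ).2 * (-(deriv γ a 1)) = 1 - n * c := by
      simp only [Prod.fst_add, Prod.snd_add, Prod.smul_fst, Prod.smul_snd, smul_eq_mul, hc]
      linear_combination hsq
    rw [e]
    have h1 : |n * c| < 1 := by
      rw [abs_mul]
      have hna : |n| < r := abs_lt.2 ⟨hn.1, hn.2⟩
      have hB0 : 0 ≤ B := (norm_nonneg _).trans (hB a)
      calc |n| * |c| ≤ |n| * B := mul_le_mul_of_nonneg_left hcB (abs_nonneg n)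
        _ ≤ r * B := mul_le_mul_of_nonneg_right hna.le hB0
        _ < 1 := hrB
    have := (abs_lt.1 h1).2
    linarith [le_abs_self (n * c)]
  -- the derivative is the invertible map `(h,k) ↦ h•u + k•w`
  obtain ⟨L, hL⟩ := exists_equiv_of_det_ne_zero (u := ((deriv γ a 0, deriv γ a 1) : ℝ × ℝ) + n • ((-(deriv (deriv γ) a 1), deriv (deriv γ) a 0) : ℝ × ℝ))
    (w := ((-(deriv γ a 1), deriv γ a 0) : ℝ × ℝ)) (by simpa using hdet)
  refine ⟨L, ?_⟩
  have hF := hasFDerivAt_planarTube hγ2 hΦ a n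
  rw [← hL] at hF
  -- `Φ` is `C¹`, so the derivative is strict
  have hΦc1 : ContDiffAt ℝ 1 Φ (a, n) := by
    have hΦeq : Φ = fun p : ℝ × ℝ => ((γ p.1 0 + p.2 * (-(deriv γ p.1 1)), γ p.1 1 + p.2 * deriv γ p.1 0) : ℝ × ℝ) := funext hΦ
    rw [hΦeq]
    have h0 : ContDiff ℝ 1 fun a : ℝ => γ a 0 := (contDiff_piLp_apply (p := 2) (𝕜 := ℝ) (E := fun _ : Fin 3 => ℝ) (i := (0 : Fin 3))).comp (hγ2.of_le (by norm_num))
    have h1 : ContDiff ℝ 1 fun a : ℝ => γ a 1 := (contDiff_piLp_apply (p := 2) (𝕜 := ℝ) (E := fun _ : Fin 3 => ℝ) (i := (1 : Fin 3))).comp (hγ2.of_le (by norm_num))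
    have hd : ContDiff ℝ 1 (deriv γ) := hγ2.deriv'
    have hd0 : ContDiff ℝ 1 fun a : ℝ => deriv γ a 0 := (contDiff_piLp_apply (p := 2) (𝕜 := ℝ) (E := fun _ : Fin 3 => ℝ) (i := (0 : Fin 3))).comp hd
    have hd1 : ContDiff ℝ 1 fun a : ℝ => deriv γ a 1 := (contDiff_piLp_apply (p := 2) (𝕜 := ℝ) (E := fun _ : Fin 3 => ℝ) (i := (1 : Fin 3))).comp hd
    refine ContDiff.contDiffAt ?_
    exact ((h0.comp contDiff_fst).add (contDiff_snd.mul (hd1.comp contDiff_fst).neg)).prodMk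
      ((h1.comp contDiff_fst).add (contDiff_snd.mul (hd0.comp contDiff_fst)))
  have hstrict := hΦc1.hasStrictFDerivAt one_ne_zero
  rwa [hF.fderiv] at hstrict

end Summit.NavierStokesRegularity.NavierStokesRegularity.Theorems.PoloidalWindowDoorLrcModEntireRidgeQuasiconvexOpen

end
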